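import Summits.BirchSwinnertonDyer.Rank1Residual.X11b.Three.UnramifiedClassNode
import Summits.BirchSwinnertonDyer.Rank1Residual.X11b.Three.UnramifiedClassCusp
import HarnessLib

/-!
# X11b at `p = 3` (team N8/O2), S15 (C1) capstone: unramified `E₀`-valued classes of `H¹(K_v, E)`
# vanish at EVERY finite place (Milne ADT I.3.8 for `𝒜°`: good, multiplicative and additive)

HONEST FRAMING (cell `b2b-bsdres`, run/shared/lean/b2b/bsd-rank1-residual/, verbatim in every
file): the goal of the cell is to DELETE the COMBINATION-SHAPED residual classes of the
Birch–Swinnerton-Dyer formula for ALL analytic-rank `≤ 1` elliptic curves over `ℚ` — "full BSD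
formula for every rank `≤ 1` curve in class `C`" assembled STRICTLY from published theorems — so
that the rank-`≤ 1` remainder becomes exactly the CONSTRUCTION-SHAPED classes, which are TYPED
(missing-input `Prop`s), NOT attempted. This is not "finishing BSD". Team N8/O2 = `x11b3`, seat
`b2b-bsdres-x11b3-p8` (GEN 3), S15 (C1) road (LEAD DEAL #7 R7-16a / R7-26 / R7-35). LABEL OF
RECORD: flag-discharge hygiene for `JET@p|N` (harvest E66 (D)) — NOT count-moving; nothing is
booked; `O2` OPEN. THEOREMS ONLY: no definition, no named fact, no `sorry`.

## What

One theorem, `oneCocycleClass_eq_zero_of_subset_E0`: for `W/K` elliptic, ANY finite place `v`, the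
prime `𝔐` of `\bar 𝓞_v` with inertia group `I_𝔐 ≤ Γ_{K_v}`, and any subgroup `B ≤ E(K̄_v)` whose
points have nonsingular reduction on the minimal model at `v` (`B ⊆ E₀`, read through the tree's
transport `Φ` determined by the witnesses `w`, `ι`, `C`), every continuous crossed homomorphism
`f : Γ_{K_v} → E(K̄_v)` with values in `B` vanishing on `I_𝔐` has trivial class in `H¹(K_v, E)` —
Milne, *ADT*, Prop. I.3.8, "`H¹(G/I, 𝒜°(R^{un})) = 0`", with NO reduction hypothesis: the three
reduction types of the minimal model (tree
`hasGoodReductionAt_or_hasMultiplicativeReductionAt_or_hasAdditiveReductionAt`) are covered by the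
tree's `Milne2006_unramifiedClass_eq_zero_holds` (good reduction; `B` unused), the cell's
`oneCocycleClass_eq_zero_of_hasMultiplicativeReductionAt` (p256686, a node: torus) and
`oneCocycleClass_eq_zero_of_hasAdditiveReductionAt` (p259017, a cusp: `𝔾_a`). This is the
hypothesis `hvanish` of x11b3-p1's END FORM (p254200) at every finite place; the END-FORM assembly
over all places is x11b3-p2's (iv) (`KolyvaginClassBadPlaceEndS15`), which may cite this theorem.

HONEST CONSEQUENCE (LEAD R7-16a (3) / R7-35): NOT a discharge of `JET@p|N` — all component-group
content (`Φ_v`, `c_v`) lives in "the Kolyvagin cocycle is `B ⊆ E₀`-valued" = binder `hGZ31`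
([GZ86, III (3.1)]); no Tamagawa hypothesis here BECAUSE the receptacle is `E₀`. Nothing booked.

References (locators only; no cited FACT): [cite: MilneADT2006, Ch. I Prop. 3.8]
[cite: GrossLMS1991, Prop. 6.2 (1), p. 244]; cell files p255910, p256222, p256473, p256686,
p258381, p259017 (p8); tree `PeriodIndexSupportProofs` (`Milne2006_unramifiedClass_eq_zero_holds`).
-/

noncomputable section

open scoped Classical NNReal
open NumberField IsDedekindDomain Field

universe u

namespace Summit.BirchSwinnertonDyer.Rank1Residual.X11b.Three.UnramifiedNode

open WeierstrassCurve Literature.NumberTheory.EllipticCurves Literature.NumberTheory.GaloisRepresentations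
  IsDedekindDomain.HeightOneSpectrum

variable {K : Type u} [Field K] [NumberField K]

/-- **Milne ADT I.3.8 for `𝒜° = E₀` at EVERY finite place** (`H¹(K_v^{nr}/K_v, E₀(K_v^{nr})) → H¹(K_v, E)`
is zero): for any subgroup `B ≤ E(K̄_v)` of points with nonsingular reduction on the minimal
model at `v` (hypothesis `hB`, through the tree's transport determined by `w`, `ι`, `C`), a
continuous crossed homomorphism `f : Γ_{K_v} → E(K̄_v)` with values in `B` and vanishing on the
inertia group `I_𝔐` has trivial class — whatever the reduction type of `E` at `v`: good (the
tree's `Milne2006_unramifiedClass_eq_zero_holds`), multiplicative (the cell's node theorem) or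
additive (the cell's cusp theorem). The hypothesis `hvanish` of the END FORM p254200 at every
finite place; NOT a discharge of `JET@p|N` (component-group content in `hGZ31`).
[cite: MilneADT2006, Ch. I Prop. 3.8] [cite: GrossLMS1991, Prop. 6.2 (1), p. 244] -/
theorem oneCocycleClass_eq_zero_of_subset_E0 (W : WeierstrassCurve K) [W.IsElliptic]
    (v : HeightOneSpectrum (𝓞 K)) {𝔐 : Ideal v.localAbsIntegers} (h𝔐 : 𝔐 ∈ v.localPrimesAbove)
    {w : Valuation (AlgebraicClosure (v.adicCompletion K)) ℝ≥0}
    (hw : ∀ x, (w x : ℝ) = spectralNorm (v.adicCompletion K) (AlgebraicClosure (v.adicCompletion K)) x)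
    {ι : v.adicCompletionIntegers K →+* w.integer}
    (hι : ∀ a, ((ι a : w.integer) : AlgebraicClosure (v.adicCompletion K)) =
      algebraMap (v.adicCompletion K) (AlgebraicClosure (v.adicCompletion K)) (a : v.adicCompletion K))
    {C : VariableChange (v.adicCompletion K)}
    (hC : C • W.baseChange (v.adicCompletion K) =
      (W.localMinimalIntegralModel v).map (algebraMap (v.adicCompletionIntegers K) (v.adicCompletion K)))
    (B : AddSubgroup (localPoints W (v.adicCompletion K)))
    (hB : ∀ Q ∈ B, ((W.localMinimalIntegralModel v).map ι).HasNonsingularReduction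
      (Affine.Point.congrEquiv (baseChange_map_eq_baseChange_map hι (W.localMinimalIntegralModel v))
        (Affine.Point.congrEquiv (congrArg (fun X : WeierstrassCurve (v.adicCompletion K) ↦
            X.baseChange (AlgebraicClosure (v.adicCompletion K))) hC)
          (VariableChange.pointEquivBaseChange (W.baseChange (v.adicCompletion K)) C
            (AlgebraicClosure (v.adicCompletion K))
            (Affine.Point.congrEquiv (baseChange_baseChange_adicCompletion W v).symm Q)))))
    (f : contOneCocycles (discreteTopRep (absoluteGaloisGroup (v.adicCompletion K))
      (localPoints W (v.adicCompletion K))))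
    (hfB : ∀ τ, f.1 τ ∈ B)
    (hfI : ∀ τ ∈ 𝔐.inertia (absoluteGaloisGroup (v.adicCompletion K)), f.1 τ = 0) :
    oneCocycleClass (discreteTopRep (absoluteGaloisGroup (v.adicCompletion K))
      (localPoints W (v.adicCompletion K))) f = 0 := by
  rcases W.hasGoodReductionAt_or_hasMultiplicativeReductionAt_or_hasAdditiveReductionAt v with
    hg | hm | ha
  · exact Milne2006_unramifiedClass_eq_zero_holds W v hg h𝔐 f hfI
  · exact oneCocycleClass_eq_zero_of_hasMultiplicativeReductionAt W hw hm h𝔐 hι hC B hB f hfB hfI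
  · exact oneCocycleClass_eq_zero_of_hasAdditiveReductionAt W hw ha h𝔐 hι hC B hB f hfB hfI

end Summit.BirchSwinnertonDyer.Rank1Residual.X11b.Three.UnramifiedNode

end
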